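import Literature.Analysis.FluidPDE.AxisymSwirlL4Algebra
import HarnessLib

/-!
# Lei–Zhang 2017, §3: the `L⁴` estimate of `v^θ` at a fixed time

Analysis/FluidPDE proof file (theorems only; no definitions, no named facts) on the discharge path
of the named fact `Literature.Analysis.FluidPDE.LeiZhang2017_logModulus_regularity`
(Lei–Zhang 2017, arXiv:1505.02628, Cor. 1.3). §3, p. 9:

> "by applying standard energy estimate to the equation of `v^θ` in (1.3), it is easy to derive
> `d/dt‖v^θ‖⁴_{L⁴} + ‖∇(v^θ)²‖² + ‖(v^θ)²/r‖² ≤ C|∫(vʳ/r)(v^θ)⁴|`, which gives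
> `v^θ ∈ L^∞L⁴`, `(v^θ)²/r ∈ L²L²`."

In the smooth Hou–Li variables (`Φ = v^θ/r`, `Γ = r²Φ`, `W = vʳ/r`; `(v^θ)⁴ = Γ²Φ²`,
`(v^θ)⁴/r² = ΓΦ³`) the `Φ`-equation `∂ₜΦ + (u·∇)Φ = ν(Δ + (2/r)∂ᵣ)Φ − 2WΦ`
(`IsClassicalNSSolutionOn.angVelQuot_eq`) paired with `Γ²Φ` gives, by the identities of
`AxisymSwirlL4Algebra`,

* `IsClassicalNSSolutionOn.swirl_L4_identity` —
  `∫ Γ²Φ Φ' + 3ν∫Γ²|∇Φ|² = 2ν∫ΓΦ³ − ∫Γ²WΦ²` (`Φ' = angVelQuot (∂ₜv)`, so `4∫Γ²ΦΦ' = d/dt∫(v^θ)⁴`);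
* `IsClassicalNSSolutionOn.swirl_L4_le` —
  **`∫ Γ²Φ Φ' + (ν/2)∫Γ²|∇Φ|² + (ν/2)∫ΓΦ³ ≤ L ∫Γ²Φ²`** whenever `|W| ≤ L` (using `∫ΓΦ³ ≤ ∫Γ²|∇Φ|²`).

## References

* Z. Lei, Q. S. Zhang, Pacific J. Math. 289 (2017) 169–187, arXiv:1505.02628, §3, p. 9.
  [`LeiZhang2017`]
-/

noncomputable section

open MeasureTheory Set Function Filter Topology InnerProductSpace WithLp
open scoped RealInnerProductSpace Laplacian ContDiff ENNReal

namespace Literature.Analysis.FluidPDE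

section L4

variable {S : Set ℝ} {ν : ℝ} {v : ℝ → EuclideanSpace ℝ (Fin 3) → EuclideanSpace ℝ (Fin 3)}
  {q : ℝ → EuclideanSpace ℝ (Fin 3) → ℝ}

/-- **The `L⁴` identity** `∫ Γ²Φ Φ' + 3ν∫Γ²|∇Φ|² = 2ν∫ΓΦ³ − ∫Γ²WΦ²` at a fixed time of a classical
axisymmetric solution (`u = v t` bounded with bounded derivative and bounded swirl,
`Φ, ∂ᵢΦ, ∂ᵢ∂ᵢΦ, radDerivQuot Φ ∈ L²`). [cite: LeiZhang2017, §3, p. 9] -/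
theorem IsClassicalNSSolutionOn.swirl_L4_identity (hns : IsClassicalNSSolutionOn S ν 0 v q)
    (hS : UniqueDiffOn ℝ S) (hax : ∀ s ∈ S, IsAxisymmetric (v s)) {t : ℝ} (ht : t ∈ S)
    {B : ℝ} (huB : ∀ x, ‖v t x‖ ≤ B) {B' : ℝ} (hDu : ∀ x, ‖fderiv ℝ (v t) x‖ ≤ B')
    {M : ℝ} (hM : ∀ x, |swirl (v t) x| ≤ M)
    (hΦ0 : MemLp (angVelQuot (v t)) 2 volume)
    (hΦ1 : ∀ i : Fin 3, MemLp (fun x => fderiv ℝ (angVelQuot (v t)) x (EuclideanSpace.single i 1)) 2 volume)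
    (hΦ2 : ∀ i : Fin 3, MemLp (fun x => fderiv ℝ (fun y => fderiv ℝ (angVelQuot (v t)) y
      (EuclideanSpace.single i 1)) x (EuclideanSpace.single i 1)) 2 volume)
    (hq : MemLp (radDerivQuot (angVelQuot (v t))) 2 volume) :
    (∫ x, swirl (v t) x ^ 2 * angVelQuot (v t) x * angVelQuot (timeDerivWithin S v t) x) +
      3 * ν * ∫ x, swirl (v t) x ^ 2 * (fderiv ℝ (angVelQuot (v t)) x (EuclideanSpace.single 0 1) ^ 2 +
        fderiv ℝ (angVelQuot (v t)) x (EuclideanSpace.single 1 1) ^ 2 +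
        fderiv ℝ (angVelQuot (v t)) x (EuclideanSpace.single 2 1) ^ 2) =
      2 * ν * (∫ x, swirl (v t) x * angVelQuot (v t) x ^ 3) -
        ∫ x, swirl (v t) x ^ 2 * radVelQuot (v t) x * angVelQuot (v t) x ^ 2 := by
  set u := v t with hu_def
  set Φ := angVelQuot u with hΦ
  set Φ' := angVelQuot (timeDerivWithin S v t) with hΦ'
  set Γ := swirl u with hΓ
  set W := radVelQuot u with hW
  set qΦ := radDerivQuot Φ with hqΦ
  have hv : ContDiff ℝ ∞ u := hns.contDiff_velocity ht
  have hu4 : ContDiff ℝ 4 u := hv.of_le (by norm_cast)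
  have haxt : IsAxisymmetric u := hax t ht
  have hdiv : VectorCalculus.IsDivFree u := hns.divFree t ht
  -- the equation
  have heq : ∀ x, Φ' x + fderiv ℝ Φ x (u x) = ν * ((Δ Φ) x + 2 * qΦ x) - 2 * W x * Φ x :=
    fun x => hns.angVelQuot_eq hS hax ht x
  -- the identities
  obtain ⟨iX, iP, iD, iWt, iY, iT⟩ := LeiZhang2017.integrable_swirl_L4_terms haxt hu4 huB hDu hM hΦ0 hΦ1 hq
  have hT := LeiZhang2017.integral_swirl_sq_angVelQuot_transport haxt hu4 hdiv huB hDu hM hΦ0 hΦ1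
  have hX := LeiZhang2017.integral_swirl_sq_angVelQuot_radDerivQuot haxt hu4 huB hDu hM hΦ0 hΦ1 hq
  have hV := LeiZhang2017.integral_swirl_sq_angVelQuot_laplacian haxt hu4 huB hM hΦ0 hΦ1 hΦ2 hq
  -- `a Φ'` as a combination of integrable terms
  set a : EuclideanSpace ℝ (Fin 3) → ℝ := fun x => Γ x ^ 2 * Φ x with ha
  have hpt : ∀ x, a x * Φ' x = -(a x * fderiv ℝ Φ x (u x)) + ν * (a x * (Δ Φ) x) +
      2 * ν * (Γ x ^ 2 * Φ x * qΦ x) - 2 * (Γ x ^ 2 * W x * Φ x ^ 2) := by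
    intro x
    have : Φ' x = -fderiv ℝ Φ x (u x) + ν * ((Δ Φ) x + 2 * qΦ x) - 2 * W x * Φ x := by
      linarith [heq x]
    rw [this]; simp only [ha]; ring
  -- integrability of `a ΔΦ` from the identity's proof: via the sum formula
  have iL : Integrable (fun x => a x * (Δ Φ) x) volume := by
    -- `a ΔΦ = a Φ' + a DΦ[u] − 2ν Γ²Φq + 2Γ²WΦ²`; instead bound directly: `|a ΔΦ| ≤ M²|Φ ΔΦ|`
    have hΦc2 : ContDiff ℝ 2 Φ := contDiff_angVelQuot (n := 2) (by exact_mod_cast hu4)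
    have hlap : ∀ x, (Δ Φ) x =
        fderiv ℝ (fun y => fderiv ℝ Φ y (EuclideanSpace.single 0 1)) x (EuclideanSpace.single 0 1) +
        fderiv ℝ (fun y => fderiv ℝ Φ y (EuclideanSpace.single 1 1)) x (EuclideanSpace.single 1 1) +
        fderiv ℝ (fun y => fderiv ℝ Φ y (EuclideanSpace.single 2 1)) x (EuclideanSpace.single 2 1) := by
      intro x
      rw [laplacian_eq_sum_fderiv_fderiv (EuclideanSpace.basisFun (Fin 3) ℝ) hΦc2 x]
      simp only [EuclideanSpace.basisFun_apply, Fin.sum_univ_three]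
    have iJ : ∀ i : Fin 3, Integrable (fun x => Φ x *
        fderiv ℝ (fun y => fderiv ℝ Φ y (EuclideanSpace.single i 1)) x (EuclideanSpace.single i 1)) volume :=
      fun i => hΦ0.integrable_mul (hΦ2 i)
    have iΦL : Integrable (fun x => Φ x * (Δ Φ) x) volume := by
      have := ((iJ 0).add (iJ 1)).add (iJ 2)
      refine this.congr (Eventually.of_forall fun x => ?_)
      simp only [Pi.add_apply]
      rw [hlap x]; ring
    have hΓc : Continuous Γ := by
      rw [show Γ = fun x => (x 0 ^ 2 + x 1 ^ 2) * Φ x from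
        LeiZhang2017.swirl_eq_horizSq_mul_angVelQuot haxt (hu4.of_le (by norm_cast))]
      exact (contDiff_horizSq (n := 0)).continuous.mul hΦc2.continuous
    have hLc : Continuous (Δ Φ) := by
      have h := fun i : Fin 3 => (contDiff_fderiv_apply_const_succ (n := 1) (by exact_mod_cast hΦc2)
        (EuclideanSpace.single i 1)).continuous_fderiv one_ne_zero
      have : (Δ Φ) = fun x =>
          fderiv ℝ (fun y => fderiv ℝ Φ y (EuclideanSpace.single 0 1)) x (EuclideanSpace.single 0 1) +
          fderiv ℝ (fun y => fderiv ℝ Φ y (EuclideanSpace.single 1 1)) x (EuclideanSpace.single 1 1) +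
          fderiv ℝ (fun y => fderiv ℝ Φ y (EuclideanSpace.single 2 1)) x (EuclideanSpace.single 2 1) :=
        funext hlap
      rw [this]
      exact (((h 0).clm_apply continuous_const).add ((h 1).clm_apply continuous_const)).add
        ((h 2).clm_apply continuous_const)
    refine ((iΦL.norm).const_mul (M ^ 2)).mono' (((hΓc.pow 2).mul hΦc2.continuous).mul hLc).aestronglyMeasurable
      (Eventually.of_forall fun x => ?_)
    rw [Real.norm_eq_abs, Real.norm_eq_abs]
    simp only [ha]
    rw [mul_assoc, abs_mul, abs_of_nonneg (sq_nonneg (Γ x))]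
    have hΓ2 : Γ x ^ 2 ≤ M ^ 2 := by rw [← sq_abs]; exact pow_le_pow_left₀ (abs_nonneg _) (hM x) 2
    exact mul_le_mul_of_nonneg_right hΓ2 (abs_nonneg _)
  -- integrate the pointwise identity
  have i1 : Integrable (fun x => -(a x * fderiv ℝ Φ x (u x))) volume := iT.neg
  have i2 : Integrable (fun x => ν * (a x * (Δ Φ) x)) volume := iL.const_mul ν
  have i3 : Integrable (fun x => 2 * ν * (Γ x ^ 2 * Φ x * qΦ x)) volume := iX.const_mul _
  have i4 : Integrable (fun x => 2 * (Γ x ^ 2 * W x * Φ x ^ 2)) volume := iWt.const_mul _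
  have i12 : Integrable (fun x => -(a x * fderiv ℝ Φ x (u x)) + ν * (a x * (Δ Φ) x)) volume := i1.add i2
  have i123 : Integrable (fun x => -(a x * fderiv ℝ Φ x (u x)) + ν * (a x * (Δ Φ) x) +
      2 * ν * (Γ x ^ 2 * Φ x * qΦ x)) volume := i12.add i3
  have hInt : ∫ x, a x * Φ' x = -(∫ x, a x * fderiv ℝ Φ x (u x)) + ν * (∫ x, a x * (Δ Φ) x) +
      2 * ν * (∫ x, Γ x ^ 2 * Φ x * qΦ x) - 2 * ∫ x, Γ x ^ 2 * W x * Φ x ^ 2 := by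
    rw [integral_congr_ae (Eventually.of_forall hpt), integral_sub i123 i4,
      integral_add i12 i3, integral_add i1 i2, integral_neg, integral_const_mul, integral_const_mul,
      integral_const_mul]
  simp only [ha] at hInt
  rw [hInt, hT, hV, hX]
  ring

/-- **The `L⁴` estimate of `v^θ` at a fixed time**: with `|W| = |vʳ/r| ≤ L`,
`∫ Γ²Φ Φ' + (ν/2)∫Γ²|∇Φ|² + (ν/2)∫ΓΦ³ ≤ L ∫ Γ²Φ²` (`ν ≥ 0`; `4∫Γ²ΦΦ' = d/dt‖v^θ‖⁴₄`,
`∫Γ²Φ² = ‖v^θ‖⁴₄`, `∫ΓΦ³ = ‖(v^θ)²/r‖²₂`). [cite: LeiZhang2017, §3, p. 9] -/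
theorem IsClassicalNSSolutionOn.swirl_L4_le (hns : IsClassicalNSSolutionOn S ν 0 v q)
    (hS : UniqueDiffOn ℝ S) (hax : ∀ s ∈ S, IsAxisymmetric (v s)) (hν : 0 ≤ ν) {t : ℝ} (ht : t ∈ S)
    {B : ℝ} (huB : ∀ x, ‖v t x‖ ≤ B) {B' : ℝ} (hDu : ∀ x, ‖fderiv ℝ (v t) x‖ ≤ B')
    {M : ℝ} (hM : ∀ x, |swirl (v t) x| ≤ M) {L : ℝ} (hL : ∀ x, |radVelQuot (v t) x| ≤ L)
    (hΦ0 : MemLp (angVelQuot (v t)) 2 volume)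
    (hΦ1 : ∀ i : Fin 3, MemLp (fun x => fderiv ℝ (angVelQuot (v t)) x (EuclideanSpace.single i 1)) 2 volume)
    (hΦ2 : ∀ i : Fin 3, MemLp (fun x => fderiv ℝ (fun y => fderiv ℝ (angVelQuot (v t)) y
      (EuclideanSpace.single i 1)) x (EuclideanSpace.single i 1)) 2 volume)
    (hq : MemLp (radDerivQuot (angVelQuot (v t))) 2 volume) :
    (∫ x, swirl (v t) x ^ 2 * angVelQuot (v t) x * angVelQuot (timeDerivWithin S v t) x) +
      ν / 2 * (∫ x, swirl (v t) x ^ 2 * (fderiv ℝ (angVelQuot (v t)) x (EuclideanSpace.single 0 1) ^ 2 +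
        fderiv ℝ (angVelQuot (v t)) x (EuclideanSpace.single 1 1) ^ 2 +
        fderiv ℝ (angVelQuot (v t)) x (EuclideanSpace.single 2 1) ^ 2)) +
      ν / 2 * (∫ x, swirl (v t) x * angVelQuot (v t) x ^ 3) ≤
      L * ∫ x, swirl (v t) x ^ 2 * angVelQuot (v t) x ^ 2 := by
  have hid := hns.swirl_L4_identity hS hax ht huB hDu hM hΦ0 hΦ1 hΦ2 hq
  have hv : ContDiff ℝ ∞ (v t) := hns.contDiff_velocity ht
  have hu4 : ContDiff ℝ 4 (v t) := hv.of_le (by norm_cast)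
  have haxt : IsAxisymmetric (v t) := hax t ht
  obtain ⟨-, iP, iD, iWt, iY, -⟩ := LeiZhang2017.integrable_swirl_L4_terms haxt hu4 huB hDu hM hΦ0 hΦ1 hq
  have hPD := LeiZhang2017.integral_swirl_angVelQuot_cube_le haxt hu4 huB hDu hM hΦ0 hΦ1 hq
  -- `−∫Γ²WΦ² ≤ L ∫Γ²Φ²`
  have hWY : -∫ x, swirl (v t) x ^ 2 * radVelQuot (v t) x * angVelQuot (v t) x ^ 2 ≤
      L * ∫ x, swirl (v t) x ^ 2 * angVelQuot (v t) x ^ 2 := by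
    rw [← integral_neg, ← integral_const_mul]
    refine integral_mono iWt.neg (iY.const_mul L) fun x => ?_
    have h1 : 0 ≤ swirl (v t) x ^ 2 * angVelQuot (v t) x ^ 2 := by positivity
    have h2 := neg_abs_le (radVelQuot (v t) x)
    have h3 := hL x
    have : -(swirl (v t) x ^ 2 * radVelQuot (v t) x * angVelQuot (v t) x ^ 2) =
        (-radVelQuot (v t) x) * (swirl (v t) x ^ 2 * angVelQuot (v t) x ^ 2) := by ring
    rw [this]
    exact mul_le_mul_of_nonneg_right (by linarith) h1
  have hP0 : 0 ≤ ∫ x, swirl (v t) x * angVelQuot (v t) x ^ 3 := by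
    refine integral_nonneg fun x => ?_
    have h := haxt.cylRadius_sq_mul_angVelQuot (hu4.of_le (by norm_cast)) x
    have : swirl (v t) x * angVelQuot (v t) x ^ 3 = cylRadius x ^ 2 * angVelQuot (v t) x ^ 4 := by
      rw [← h]; ring
    rw [this]; positivity
  nlinarith [hid, hWY, hPD, hP0, mul_nonneg hν hP0, mul_le_mul_of_nonneg_left hPD hν]

end L4

end Literature.Analysis.FluidPDE
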